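import Summits.NavierStokesRegularity.NavierStokesRegularity.Theorems.RellichScarSimilarityCovariance
import Summits.NavierStokesRegularity.NavierStokesRegularity.Theorems.RellichScarSymmetricScarExistsRdssWitness
import Literature.Analysis.FluidPDE.BoundedWeakIsometry
import Literature.Analysis.FluidPDE.EulerTimeScaling
import Literature.Analysis.FluidPDE.AxisymGradientField

/-!
# Crux `SymmetricScarExists` (stmt-NavierStokesRegularity-11718), line `rdss-screw-split` — stub
# `stub_anyAxisScrewWitness` (AUX-5): child A accepts screw-invariant profiles about ANY axis

Helper file of the line lead (`--supports stmt-NavierStokesRegularity-11718`; theorems only, no definitions,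
no named facts).  The `SO(3)` bookkeeping of Disproof §10 for child A (`RdssScarSelection`) of the screw
split.  Let `u` be a singular apex profile — a suitable weak Navier–Stokes solution on the slab
`(−∞, 0) × ℝ³` with a weak gradient, `𝐈 < ∞`, the apex bound `‖u(t,x)‖ ≤ C/(‖x‖ + √−t)` and the origin
backward-singular — which is a.e. fixed on the slab by `u ↦ R (D_c u)(t, R⁻¹ x)`, `c > 1`,
`(D_c u)(t,x) = c u(c²t, cx)`, for a linear isometry `R` of `ℝ³` given in normal form `R = Q ∘ R_θ ∘ Q⁻¹`
(`R_θ = rotZ θ`, the rotation about the `x₃`-axis).  Then the conjugate `v(t, x) := Q⁻¹ u(t, Q x)`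

* is again a singular apex profile with the SAME constant `C` (rotation covariance of the apex class,
  `RellichScarSimilarityCovariance.apexClass_conj` applied to `Q⁻¹`);
* is a.e. fixed on the slab by the `e₃`-screw `(c, θ)`: pointwise
  `R_θ (D_c v)(t, R_{−θ} x) = Q⁻¹ (R (D_c u)(t, R⁻¹ (Q x)))` (linearity of `Q`, `R`, and the two
  consequences `Q⁻¹ R = R_θ Q⁻¹`, `R⁻¹ Q = Q R_{−θ}` of the normal form), and the a.e. hypothesis is
  transported along the measure-preserving map `(t, x) ↦ (t, Q x)` of the slab
  (`measurePreserving_prodMap_linearIsometryEquiv_slab`);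

hence A's conclusion holds with `C' = C` (`RdssSplit.rdssScarSelection_witness_of_aeScrewInvariant`).

## References

* G. Koch, N. Nadirashvili, G. Seregin, V. Šverák, Acta Math. 203 (2009), §1 (rotation and scaling
  symmetries of the equations). [folklore]
* Z. Bradshaw, T.-P. Tsai, Comm. PDE 42 (2017), §1 (rotated discretely self-similar fields). [folklore]
-/

noncomputable section

open MeasureTheory Set Function Filter Topology TopologicalSpace Metric
open scoped NNReal ENNReal

namespace Summit.NavierStokesRegularity.NavierStokesRegularity.Theorems.SymmetricScarExists.RdssSplit.AnyAxis

set_option linter.dupNamespace false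

open Literature.Analysis.FluidPDE
open Summit.NavierStokesRegularity.NavierStokesRegularity.Theses.RellichScar

/-- First consequence of the normal form `R = Q R_θ Q⁻¹`: `Q⁻¹ (R y) = R_θ (Q⁻¹ y)`. [folklore] -/
theorem anyAxisScrew_symm_conj_apply {θ : ℝ}
    {R Q : EuclideanSpace ℝ (Fin 3) ≃ₗᵢ[ℝ] EuclideanSpace ℝ (Fin 3)}
    (hR : ∀ x : EuclideanSpace ℝ (Fin 3), R x = Q (rotZ θ (Q.symm x)))
    (y : EuclideanSpace ℝ (Fin 3)) : Q.symm (R y) = rotZ θ (Q.symm y) := by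
  rw [hR, LinearIsometryEquiv.symm_apply_apply]

/-- Second consequence of the normal form `R = Q R_θ Q⁻¹`: `R⁻¹ (Q x) = Q (R_{−θ} x)`. [folklore] -/
theorem anyAxisScrew_symm_apply_conj {θ : ℝ}
    {R Q : EuclideanSpace ℝ (Fin 3) ≃ₗᵢ[ℝ] EuclideanSpace ℝ (Fin 3)}
    (hR : ∀ x : EuclideanSpace ℝ (Fin 3), R x = Q (rotZ θ (Q.symm x)))
    (x : EuclideanSpace ℝ (Fin 3)) : R.symm (Q x) = Q (rotZ (-θ) x) := by
  have h1 : R (Q (rotZ (-θ) x)) = Q x := by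
    rw [hR, LinearIsometryEquiv.symm_apply_apply, rotZ_apply_rotZ_neg]
  calc R.symm (Q x) = R.symm (R (Q (rotZ (-θ) x))) := by rw [h1]
    _ = Q (rotZ (-θ) x) := R.symm_apply_apply _

/-- **Pointwise conjugation identity.** For `R = Q R_θ Q⁻¹` and `v(t,x) = Q⁻¹ u(t, Q x)`:
`R_θ (D_c v)(t, R_{−θ} x) = Q⁻¹ (R (D_c u)(t, R⁻¹ (Q x)))` for all `t, x`. [folklore] -/
theorem anyAxisScrew_conj_pointwise (u : ℝ → EuclideanSpace ℝ (Fin 3) → EuclideanSpace ℝ (Fin 3))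
    (c θ : ℝ) {R Q : EuclideanSpace ℝ (Fin 3) ≃ₗᵢ[ℝ] EuclideanSpace ℝ (Fin 3)}
    (hR : ∀ x : EuclideanSpace ℝ (Fin 3), R x = Q (rotZ θ (Q.symm x))) (t : ℝ)
    (x : EuclideanSpace ℝ (Fin 3)) :
    rotZ θ (nsRescale c (fun s y => Q.symm (u s (Q y))) t (rotZ (-θ) x)) =
      Q.symm (R (nsRescale c u t (R.symm (Q x)))) := by
  simp only [nsRescale_apply, anyAxisScrew_symm_apply_conj hR, anyAxisScrew_symm_conj_apply hR,
    LinearIsometryEquiv.map_smul, rotZ_smul]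

/-- **A.e. screw invariance of the conjugate.** If `R (D_c u)(t, R⁻¹ x) = u(t, x)` a.e. on the slab and
`R = Q R_θ Q⁻¹`, then `v(t,x) = Q⁻¹ u(t, Q x)` satisfies `R_θ (D_c v)(t, R_{−θ} x) = v(t, x)` a.e. on the
slab: transport along the measure-preserving `(t, x) ↦ (t, Q x)` and the pointwise identity. [folklore] -/
theorem anyAxisScrew_conj_ae (u : ℝ → EuclideanSpace ℝ (Fin 3) → EuclideanSpace ℝ (Fin 3))
    (c θ : ℝ) {R Q : EuclideanSpace ℝ (Fin 3) ≃ₗᵢ[ℝ] EuclideanSpace ℝ (Fin 3)}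
    (hR : ∀ x : EuclideanSpace ℝ (Fin 3), R x = Q (rotZ θ (Q.symm x)))
    (hae : uncurry (fun t x => R (nsRescale c u t (R.symm x)))
      =ᵐ[volume.restrict (Iio (0 : ℝ) ×ˢ (univ : Set (EuclideanSpace ℝ (Fin 3))))] uncurry u) :
    uncurry (fun t x => rotZ θ (nsRescale c (fun s y => Q.symm (u s (Q y))) t (rotZ (-θ) x)))
      =ᵐ[volume.restrict (Iio (0 : ℝ) ×ˢ (univ : Set (EuclideanSpace ℝ (Fin 3))))]
      uncurry (fun s y => Q.symm (u s (Q y))) := by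
  have he := measurePreserving_prodMap_linearIsometryEquiv_slab Q (Iio (0 : ℝ)) measurableSet_Iio
  have h2 := he.quasiMeasurePreserving.ae_eq_comp hae
  filter_upwards [h2] with z hz
  have hz' : R (nsRescale c u z.1 (R.symm (Q z.2))) = u z.1 (Q z.2) := by
    simpa only [comp_apply, uncurry, Prod.map_fst, Prod.map_snd, id] using hz
  show rotZ θ (nsRescale c (fun s y => Q.symm (u s (Q y))) z.1 (rotZ (-θ) z.2)) =
    Q.symm (u z.1 (Q z.2))
  rw [anyAxisScrew_conj_pointwise u c θ hR, hz']

/-- AUX-5 `stub_anyAxisScrewWitness` — **child A accepts screw-invariant profiles about ANY axis**: if a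
singular apex profile is a.e. fixed on the slab by `u ↦ R (c u(c²t, c R⁻¹x))`, `c > 1`, for a linear isometry
`R` in normal form `R = Q R_θ Q⁻¹`, then the conjugate `Q⁻¹ u(t, Q x)` is a singular apex profile (same `C`,
`RellichScarSimilarityCovariance.apexClass_conj`) a.e. fixed by the `e₃`-screw `(c, θ)`, hence A's conclusion
holds (`rdssScarSelection_witness_of_aeScrewInvariant`) with `C' = C`. [folklore] -/
theorem stub_anyAxisScrewWitness :
    ∀ (u : ℝ → EuclideanSpace ℝ (Fin 3) → EuclideanSpace ℝ (Fin 3)) (p : ℝ → EuclideanSpace ℝ (Fin 3) → ℝ) (G : ℝ → EuclideanSpace ℝ (Fin 3) → EuclideanSpace ℝ (Fin 3) →L[ℝ] EuclideanSpace ℝ (Fin 3)) (C c θ : ℝ) (R Q : EuclideanSpace ℝ (Fin 3) ≃ₗᵢ[ℝ] EuclideanSpace ℝ (Fin 3)), Literature.Analysis.FluidPDE.IsSuitableWeakSolutionOn (Literature.Analysis.FluidPDE.slab (EuclideanSpace ℝ (Fin 3)) (Set.Iio 0) isOpen_Iio) 1 0 u p → Literature.Analysis.FluidPDE.HasWeakSpatialGradientOn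 (Literature.Analysis.FluidPDE.slab (EuclideanSpace ℝ (Fin 3)) (Set.Iio 0) isOpen_Iio) u G → Literature.Analysis.FluidPDE.typeIBound (Set.Iio (0 : ℝ) ×ˢ Set.univ) u p G < ⊤ → Literature.Analysis.FluidPDE.HasTypeIDecay C u → Literature.Analysis.FluidPDE.IsBackwardSingularPoint u 0 → 1 < c → (∀ x : EuclideanSpace ℝ (Fin 3), R x = Q (Literature.Analysis.FluidPDE.rotZ θ (Q.symm x))) → Function.uncurry (fun t x => R (Literature.Analysis.FluidPDE.nsRescale c u t (R.symm x))) =ᵐ[MeasureTheory.volume.restrict (Set.Iio (0 : ℝ) ×ˢ Set.univ)] Function.uncurry u → ∃ (C' : ℝ) (u : ℝ → EuclideanSpace ℝ (Fin 3) → EuclideanSpace ℝ (Fin 3)) (p : ℝ → EuclideanSpace ℝ (Fin 3) → ℝ) (G : ℝ → EuclideanSpace ℝ (Fin 3) → EuclideanSpace ℝ (Fin 3) →L[ℝ] EuclideanSpace ℝ (Fin 3)), Literature.Analysis.FluidPDE.IsSuitableWeakSolutionOn (Literature.Analysis.FluidPDE.slab (EuclideanSpace ℝ (Fin 3)) (Set.Iio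 0) isOpen_Iio) 1 0 u p ∧ Literature.Analysis.FluidPDE.HasWeakSpatialGradientOn (Literature.Analysis.FluidPDE.slab (EuclideanSpace ℝ (Fin 3)) (Set.Iio 0) isOpen_Iio) u G ∧ Literature.Analysis.FluidPDE.typeIBound (Set.Iio (0 : ℝ) ×ˢ Set.univ) u p G < ⊤ ∧ Literature.Analysis.FluidPDE.HasTypeIDecay C' u ∧ Literature.Analysis.FluidPDE.IsBackwardSingularPoint u 0 ∧ ((∃ c θ : ℝ, 1 < c ∧ ∀ K : Set (EuclideanSpace ℝ (Fin 3)), IsCompact K → (0 : EuclideanSpace ℝ (Fin 3)) ∉ K → Filter.Tendsto (fun δ : ℝ => MeasureTheory.eLpNorm (Function.uncurry (fun t x => Literature.Analysis.FluidPDE.rotZ θ (Literature.Analysis.FluidPDE.nsRescale c u t (Literature.Analysis.FluidPDE.rotZ (-θ) x))) - Function.uncurry u) ⊤ (MeasureTheory.volume.restrict (Set.Ioo (-δ) 0 ×ˢ K))) (nhdsWithin 0 (Set.Ioi 0)) (nhds 0)) ∨ (∀ θ : ℝ, ∀ K : Set (EuclideanSpace ℝ (Fin 3)), IsCompact K → (0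 : EuclideanSpace ℝ (Fin 3)) ∉ K → Filter.Tendsto (fun δ : ℝ => MeasureTheory.eLpNorm (Function.uncurry (fun t x => Literature.Analysis.FluidPDE.rotZ θ (u t (Literature.Analysis.FluidPDE.rotZ (-θ) x))) - Function.uncurry u) ⊤ (MeasureTheory.volume.restrict (Set.Ioo (-δ) 0 ×ˢ K))) (nhdsWithin 0 (Set.Ioi 0)) (nhds 0))) := by
  intro u p G C c θ R Q hsw hG hI hC hsing hc hR hae
  have key :=
    Summit.NavierStokesRegularity.NavierStokesRegularity.Theorems.RellichScarSimilarityCovariance.apexClass_conj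
      hsw hG hI hC hsing Q.symm
  simp only [LinearIsometryEquiv.symm_symm] at key
  obtain ⟨q, H, hsw', hG', hI', hC', hsing'⟩ := key
  exact
    Summit.NavierStokesRegularity.NavierStokesRegularity.Theorems.SymmetricScarExists.RdssSplit.rdssScarSelection_witness_of_aeScrewInvariant
      (fun s y => Q.symm (u s (Q y))) q H C c θ hsw' hG' hI' hC' hsing' hc
      (anyAxisScrew_conj_ae u c θ hR hae)

end Summit.NavierStokesRegularity.NavierStokesRegularity.Theorems.SymmetricScarExists.RdssSplit.AnyAxis

end
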